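import Mathlib
import Literature.MathematicalPhysics.QuantumLattice.Imbrie2016.LLA
import Literature.MathematicalPhysics.QuantumLattice.Imbrie2016.LocalLawCompactness
import Literature.MathematicalPhysics.QuantumLattice.Imbrie2016.SmallGapDictionary
import HarnessLib

/-!
# Imbrie (2016), Assumption LLA: local linear small-gap laws on the unit sphere of coupling space
# globalise to the unit ball — instantiated for the chain Hamiltonian (1.1)

CITATION HEADER (lean-in-tree rule 2026-08-18). J. Z. Imbrie, *On many-body localization for quantum spin chains*,
J. Stat. Phys. **163** (2016) 998–1048, doi 10.1007/s10955-016-1508-x, arXiv:1403.7837 [ImbrieJSP2016], §1 eq. (1.1) (the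
chain), eq. (1.3) = (5.2) (Assumption LLA(ν, C): `P(min_{α≠β} |E_α − E_β| < δ) ≤ δ^ν C^n`), Ch. 5 eq. (5.3) (radial scaling).
WHAT IS REPRODUCED: nothing of the paper's proofs. This file COMPOSES three kernel-checked pieces of the audit cell `pub-imbrie`
(LLA.md blocks Q7, WD): the abstract globalisation `LocalLawCompactness.ball_law_smallGap` (dyadic shells + compactness of the
sphere, for any operator family positively homogeneous of degree one), the homogeneity `SmallGapDictionary.Hop_posHomogeneous`
of the chain Hamiltonian in its coupling triple `(h, Γ, J)` at fixed `γ`, and the min–max dictionary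
`SmallGapDictionary.setOf_SmallGap_subset_smallGap` / `smallGap_subset_setOf_SmallGap` between the paper's event
`SmallGap γ δ` ("two eigenvalues closer than δ", LLA.lean) and the 2-plane quasimode event `smallGap`. RESULT
(`ball_law_SmallGap_chain`, `ball_law_SmallGap_chain'`): for the `n`-site chain (`n ≥ 1`), if every point of the unit sphere
of coupling space `Triple n` (sup norm — the unit ball is the cube `[-1,1]^{3n+1}`) has a neighbourhood on which Lebesgue measure
of `{SmallGap γ δ} ∩ (a closed polyhedral cone)` is `≤ C δ` for all `δ > 0`, then the same linear law holds on the whole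
punctured unit ball intersected with the cone, with a finite constant.

STATUS / HONESTY: this is the measure-theoretic skeleton '(L_box)-type linear law ⟸ local linear laws on the sphere' in the
chain's own terms, for LEBESGUE measure on coupling space; the transfer to product laws with bounded densities (a factor
`ρ₀^{3n+1}`) and, above all, the LOCAL LAWS THEMSELVES are NOT proved here. Assumption LLA remains an OPEN hypothesis of
Theorem 1.1; nothing in this file asserts it.
-/

noncomputable section

namespace Literature.MathematicalPhysics.QuantumLattice.Imbrie2016.ChainBallLaw

open _root_.MeasureTheory Set Filter SmallGapDictionary LocalLawCompactness
open scoped ENNReal Topology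

/-- [cite: ImbrieJSP2016, §1 eq. (1.1)] Coupling space of the `n`-site box has dimension `3n + 1`
(`n` fields, `n` transverse fields, `n + 1` bonds). -/
theorem finrank_triple (n : ℕ) : Module.finrank ℝ (Triple n) = 3 * n + 1 := by
  simp only [Triple, Module.finrank_prod, Module.finrank_fin_fun]
  ring

/-- [cite: ImbrieJSP2016, §1 (laws supported in [-1,1])] Lebesgue measure on `(Fin n → ℝ) × (Fin (n+1) → ℝ)` is an
additive Haar measure (product of the Pi instances; Mathlib does not infer it through `Prod`). -/
instance volume_pair_isAddHaarMeasure (n : ℕ) :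
    (volume : Measure ((Fin n → ℝ) × (Fin (n + 1) → ℝ))).IsAddHaarMeasure :=
  Measure.prod.instIsAddHaarMeasure _ _

/-- [cite: ImbrieJSP2016, §1 (laws supported in [-1,1])] Lebesgue measure on coupling space `Triple n` is an additive Haar
measure. -/
instance volume_triple_isAddHaarMeasure (n : ℕ) : (volume : Measure (Triple n)).IsAddHaarMeasure :=
  Measure.prod.instIsAddHaarMeasure _ _

/-- [cite: ImbrieJSP2016, eq. (1.3) and eq. (5.3)] Globalisation for the chain, quasimode currency: local linear laws for
`smallGap (Hop γ n) ε ∩ cone` near every point of the unit sphere of coupling space imply a linear law on the punctured unit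
ball (Lebesgue measure). Pure instantiation of `LocalLawCompactness.ball_law_smallGap` with `Hop_posHomogeneous`. -/
theorem ball_law_smallGap_chain (γ : ℝ) {n : ℕ} (hn : 1 ≤ n) {ι : Type*} (f : ι → Triple n →ₗ[ℝ] ℝ)
    (hsph : ∀ y : Triple n, ‖y‖ = 1 → ∃ U ∈ 𝓝 y, ∃ C : ℝ≥0∞, C ≠ ⊤ ∧ ∀ ε : ℝ, 0 < ε →
      volume ((smallGap (Hop γ n) ε ∩ {ω : Triple n | ∀ i, 0 ≤ f i ω}) ∩ U) ≤ C * ENNReal.ofReal ε) :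
    ∃ C' : ℝ≥0∞, C' ≠ ⊤ ∧ ∀ ε : ℝ, 0 < ε →
      volume ((smallGap (Hop γ n) ε ∩ {ω : Triple n | ∀ i, 0 ≤ f i ω}) ∩
        {x : Triple n | 0 < ‖x‖ ∧ ‖x‖ ≤ 1}) ≤ C' * ENNReal.ofReal ε :=
  ball_law_smallGap volume (by rw [finrank_triple]; omega) (Hop γ n) (Hop_posHomogeneous γ n) f hsph

/-- [cite: ImbrieJSP2016, eq. (1.3) and eq. (5.3)] **Globalisation for the chain in the paper's currency.** If near every
point of the unit sphere of coupling space the Lebesgue measure of `{t | SmallGap γ δ (H at couplings t)} ∩ cone` is `≤ C δ`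
for all `δ > 0` (a LOCAL linear small-gap law), then on the punctured unit ball `∩ cone` it is `≤ C' δ` for all `δ > 0` with
`C' < ∞`. Proof: local law for `SmallGap (3ε)` ⊇ `smallGap ε` (min–max, `smallGap_subset_setOf_SmallGap`) ⇒ quasimode local
law with constant `3C` ⇒ `ball_law_smallGap_chain` ⇒ back with `{SmallGap δ} ⊆ smallGap (δ/2)` (`setOf_SmallGap_subset_smallGap`). -/
theorem ball_law_SmallGap_chain (γ : ℝ) {n : ℕ} (hn : 1 ≤ n) {ι : Type*} (f : ι → Triple n →ₗ[ℝ] ℝ)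
    (hsph : ∀ y : Triple n, ‖y‖ = 1 → ∃ U ∈ 𝓝 y, ∃ C : ℝ≥0∞, C ≠ ⊤ ∧ ∀ δ : ℝ, 0 < δ →
      volume (({t : Triple n | SmallGap γ δ (Params.ofTriple t)} ∩ {ω : Triple n | ∀ i, 0 ≤ f i ω}) ∩ U)
        ≤ C * ENNReal.ofReal δ) :
    ∃ C' : ℝ≥0∞, C' ≠ ⊤ ∧ ∀ δ : ℝ, 0 < δ →
      volume (({t : Triple n | SmallGap γ δ (Params.ofTriple t)} ∩ {ω : Triple n | ∀ i, 0 ≤ f i ω}) ∩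
        {x : Triple n | 0 < ‖x‖ ∧ ‖x‖ ≤ 1}) ≤ C' * ENNReal.ofReal δ := by
  -- Step 1: the quasimode-currency local hypothesis with constant 3C.
  have hsph' : ∀ y : Triple n, ‖y‖ = 1 → ∃ U ∈ 𝓝 y, ∃ C : ℝ≥0∞, C ≠ ⊤ ∧ ∀ ε : ℝ, 0 < ε →
      volume ((smallGap (Hop γ n) ε ∩ {ω : Triple n | ∀ i, 0 ≤ f i ω}) ∩ U) ≤ C * ENNReal.ofReal ε := by
    intro y hy
    obtain ⟨U, hU, C, hC, hlaw⟩ := hsph y hy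
    refine ⟨U, hU, ENNReal.ofReal 3 * C, ENNReal.mul_ne_top ENNReal.ofReal_ne_top hC, fun ε hε => ?_⟩
    have hsub : (smallGap (Hop γ n) ε ∩ {ω : Triple n | ∀ i, 0 ≤ f i ω}) ∩ U ⊆
        ({t : Triple n | SmallGap γ (3 * ε) (Params.ofTriple t)} ∩ {ω : Triple n | ∀ i, 0 ≤ f i ω}) ∩ U :=
      inter_subset_inter_left _ (inter_subset_inter_left _
        (smallGap_subset_setOf_SmallGap γ ε (3 * ε) (by linarith) n))
    calc volume ((smallGap (Hop γ n) ε ∩ {ω : Triple n | ∀ i, 0 ≤ f i ω}) ∩ U)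
        ≤ volume (({t : Triple n | SmallGap γ (3 * ε) (Params.ofTriple t)} ∩
            {ω : Triple n | ∀ i, 0 ≤ f i ω}) ∩ U) := measure_mono hsub
      _ ≤ C * ENNReal.ofReal (3 * ε) := hlaw (3 * ε) (by linarith)
      _ = ENNReal.ofReal 3 * C * ENNReal.ofReal ε := by
          rw [ENNReal.ofReal_mul (by norm_num : (0 : ℝ) ≤ 3)]; ring
  -- Step 2: globalise in quasimode currency.
  obtain ⟨C', hC', hball⟩ := ball_law_smallGap_chain γ hn f hsph'
  -- Step 3: back to the paper's currency with `{SmallGap δ} ⊆ smallGap (δ/2)`.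
  refine ⟨C', hC', fun δ hδ => ?_⟩
  have hsub : ({t : Triple n | SmallGap γ δ (Params.ofTriple t)} ∩ {ω : Triple n | ∀ i, 0 ≤ f i ω}) ∩
      {x : Triple n | 0 < ‖x‖ ∧ ‖x‖ ≤ 1} ⊆
      (smallGap (Hop γ n) (δ / 2) ∩ {ω : Triple n | ∀ i, 0 ≤ f i ω}) ∩ {x : Triple n | 0 < ‖x‖ ∧ ‖x‖ ≤ 1} :=
    inter_subset_inter_left _ (inter_subset_inter_left _ (setOf_SmallGap_subset_smallGap γ δ n))
  calc volume (({t : Triple n | SmallGap γ δ (Params.ofTriple t)} ∩ {ω : Triple n | ∀ i, 0 ≤ f i ω}) ∩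
          {x : Triple n | 0 < ‖x‖ ∧ ‖x‖ ≤ 1})
      ≤ volume ((smallGap (Hop γ n) (δ / 2) ∩ {ω : Triple n | ∀ i, 0 ≤ f i ω}) ∩
          {x : Triple n | 0 < ‖x‖ ∧ ‖x‖ ≤ 1}) := measure_mono hsub
    _ ≤ C' * ENNReal.ofReal (δ / 2) := hball (δ / 2) (by linarith)
    _ ≤ C' * ENNReal.ofReal δ := by
        gcongr
        linarith

/-- [cite: ImbrieJSP2016, eq. (1.3) and eq. (5.3)] The same without a cone (take `ι` empty): local linear laws for the
paper's small-gap event near every point of the unit sphere of coupling space `[-1,1]^{3n+1}`-cube geometry (sup norm) imply a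
linear law `≤ C' δ` on the punctured unit ball, `C' < ∞`, for Lebesgue measure. This is the skeleton of
'(L_box) ⟸ local laws'; the local laws are NOT proved here and LLA is NOT asserted. -/
theorem ball_law_SmallGap_chain' (γ : ℝ) {n : ℕ} (hn : 1 ≤ n)
    (hsph : ∀ y : Triple n, ‖y‖ = 1 → ∃ U ∈ 𝓝 y, ∃ C : ℝ≥0∞, C ≠ ⊤ ∧ ∀ δ : ℝ, 0 < δ →
      volume ({t : Triple n | SmallGap γ δ (Params.ofTriple t)} ∩ U) ≤ C * ENNReal.ofReal δ) :
    ∃ C' : ℝ≥0∞, C' ≠ ⊤ ∧ ∀ δ : ℝ, 0 < δ →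
      volume ({t : Triple n | SmallGap γ δ (Params.ofTriple t)} ∩ {x : Triple n | 0 < ‖x‖ ∧ ‖x‖ ≤ 1})
        ≤ C' * ENNReal.ofReal δ := by
  have h := ball_law_SmallGap_chain γ hn (ι := PEmpty.{1}) (fun i => i.elim)
    (by simpa only [IsEmpty.forall_iff, setOf_true, inter_univ] using hsph)
  simpa only [IsEmpty.forall_iff, setOf_true, inter_univ] using h

end Literature.MathematicalPhysics.QuantumLattice.Imbrie2016.ChainBallLaw

end
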